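import Summits.ResolutionOfSingularities.ResolutionOfSingularities.Theorems.PurelyInseparableDim4ResConeCInfVirtualEntry
import Summits.ResolutionOfSingularities.ResolutionOfSingularities.Theorems.PurelyInseparableDim4SwapTransportWindowStep
import Summits.ResolutionOfSingularities.ResolutionOfSingularities.Theorems.PurelyInseparableDim4UnitClassVertex
import HarnessLib
import HarnessLib.Audit.Tags

/-!
# Purely inseparable four-folds — THE C∞ VIRTUAL ENTRY AT A ROTATION STEP (K24b-R1 (E0), rider (R-b))
# (cell `res-dim4-pi`, K2(p) lane, slice B; C∞ assembly K24c L2b / K24b-R1 entry)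

[OURS · counted 0 · cell `res-dim4-pi` · K2(p) lane; res-dim4-typ-1 g3's rider (R-b) to the entry (bus 2026-08-29 05:52:59Z:
«please allow step k′ to be a slot step OR A ROTATION»); seat res-dim4-p-3 g4.]  Nothing here proves K2(p)/K2(5),
`NoIsolatedTrap 5 5` or resolution of singularities in dimension ≥ 4 / characteristic `p` — NOT proved.  AI kernel work,
weaker than expert review.

**`exists_cInf_virtual_entry_of_rotation`.**  INPUT: a real ROTATION step `A = step 5 univ g b A′` of the C∞ regime — the
chart is a FREE letter `g ∈ {u, f}`, the slot `κ ∈ {λ, μ}` is translated away (`b κ ≠ 0`), the other slot `κ′` is kept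
(`b κ′ = 0`); the parent `A′` carries the (E0) data of `…CInfVirtualEntry` (order `6`, ledger `x_λ x_μ ∣ F`, clean, power cone
`a₀·ℓ⁴` with `ℓ_f ≠ 0`, exact pair ledger `U·G′ = S·x_λx_μ + T·ℓ⁴`), the child `A` its REAL readings (isolated with a
certificate level `Nc`, order `6`, `e_G = 3`, ledger `x_g x_{κ′} ∣ F`).  OUTPUT, for every precision `M` and jet `N`: a framed
virtual state `B₀` related to `A` by an `ℛ²`-relation `B₀.F = clean (U⁵·(aeval θ) A.F) + E` of slot-unit class along the
bijection `π₀ = (κ g)` (virtual slots `λ, μ`, virtual free letters `u, f`; invertible free block), with the frame at jet `N`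
(order `6`, `r = x_λ x_μ ∣ F`, straight `resForm = a·x_f⁴`, exact pair-ledger support form, dead `ū²`-row below `N`,
`V(0) ≠ 0`, isolated, `e_G = 3`) — res-dim4-typ-1 g3's `hE` inner block with `π₀ = Equiv.swap κ g`.
ROUTE (= typ-1's `SwapTransport.virtual_step_rotate`, steps (2)–(7), run from the TRIVIAL relation `θ = X`, `e = 1`, `U = 1`,
`E = 0`, `π = 1` of the real parent to itself): Cramer `exists_virtual_translation_rotate` (the same point in the chart of the
dropped slot: `b′_g = 1/b_κ`) ⇒ `unitFrame_rotate₂` (the two children are `ℛ²`-related along `(κ g)`) ⇒ `det_after_rotate` ⇒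
`read_of_rel₂` (isolation and order of the virtual slot child) ⇒ `step_r_apply_six` / `forall_le_step_six` (its ledger) ⇒
res-dim4-p-7 g4's `SwapNorm.finrank_resVertex_eq_of_slotUnit_rel₂` (its `e_G`) ⇒ **`exists_cInf_virtual_entry`** at the virtual
SLOT step `step 5 univ κ b′ A′` ⇒ composition of the two relations (`deletePthPowers_aeval_deletePthPowers`, `aeval_aeval`,
and the chain rule `coeff_single_aeval_of_origin` for the free block, whose determinant multiplies).

[cite: CossartJannsenSaito2020, Thm. 3.14, Lemma 13.2] [cite: Hauser2010, §§F–G] [cite: Kollar2007, Aside 3.57]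
bears_on: LADDER-RESOLUTION:D157-DOOR2 (res-dim4-pi · K2(p) slice B · K24b-R1 entry (E0), rider (R-b)).
Supports stmt-ResolutionOfSingularities-16155 (helper).
-/

set_option linter.dupNamespace false -- mandated namespace of this single-conjunct summit

noncomputable section

namespace Summit.ResolutionOfSingularities.ResolutionOfSingularities.Theorems.PIDim4

namespace ResCone

open MvPolynomial Finset
open Literature.AlgebraicGeometry.Resolution
open Literature.AlgebraicGeometry.Resolution.CentreBlowup
open Literature.AlgebraicGeometry.Resolution.Hauser2010
open Literature.AlgebraicGeometry.Resolution.HauserPerlega2019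

variable {K : Type} [Field K]

/-- **Chain rule at the origin for linear coefficients**: for an origin-fixing substitution `θ`,
`∂_k (P∘θ)(0) = Σ_i ∂_i P(0) · ∂_k θ_i(0)`. [folklore] -/
theorem coeff_single_aeval_of_origin {θ : Fin 4 → MvPolynomial (Fin 4) K} (hθ : ∀ i, constantCoeff (θ i) = 0)
    (P : MvPolynomial (Fin 4) K) (k : Fin 4) :
    coeff (Finsupp.single k 1) (aeval θ P) =
      ∑ i, coeff (Finsupp.single i 1) P * coeff (Finsupp.single k 1) (θ i) := by
  classical
  have hk0 : (0 : Fin 4 →₀ ℕ) ≠ Finsupp.single k 1 := (Finsupp.single_ne_zero.mpr one_ne_zero).symm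
  set P₀ : MvPolynomial (Fin 4) K := P - C (constantCoeff P) with hP₀
  have hP₀0 : constantCoeff P₀ = 0 := by rw [hP₀, map_sub, constantCoeff_C, sub_self]
  have hlin : ∀ i, coeff (Finsupp.single i 1) P₀ = coeff (Finsupp.single i 1) P := fun i => by
    rw [hP₀, coeff_sub, coeff_C, if_neg (Finsupp.single_ne_zero.mpr one_ne_zero).symm, sub_zero]
  have hR := SwapNorm.sub_linearForm_mem_sq hP₀0
  have hsplit : P = C (constantCoeff P) + ∑ i, C (coeff (Finsupp.single i 1) P) * X i +
      (P₀ - ∑ i, C (coeff (Finsupp.single i 1) P₀) * X i) := by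
    simp_rw [hlin]; rw [hP₀]; ring
  conv_lhs => rw [hsplit]
  rw [map_add, map_add, coeff_add, coeff_add, aeval_C, algebraMap_eq, coeff_C, if_neg hk0, zero_add,
    SwapNorm.coeff_single_eq_zero_of_mem_sq (SwapNorm.aeval_mem_pow hθ hR), add_zero, map_sum, coeff_sum]
  refine Finset.sum_congr rfl fun i _ => ?_
  rw [map_mul, aeval_C, algebraMap_eq, aeval_X, coeff_C_mul]

/-- **The free block's determinant multiplies under composition** (`2 × 2` Cauchy–Binet at the origin): for an origin-fixing
`θ₂` fixing the two slot variables `x_λ, x_μ` exactly, the free `(u, f)`-block of `θ₂ ∘ θ′` along any labelling is the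
product of the free blocks. [folklore] -/
theorem det_free_block_comp {la mu u f : Fin 4} (hlu : la ≠ u) (hlf : la ≠ f) (hmu : mu ≠ u) (hmf : mu ≠ f) (huf : u ≠ f)
    (hex : ∀ i : Fin 4, i = la ∨ i = mu ∨ i = u ∨ i = f) {θ₂ : Fin 4 → MvPolynomial (Fin 4) K}
    (hθ₂ : ∀ i, constantCoeff (θ₂ i) = 0) (hla : θ₂ la = X la) (hmu' : θ₂ mu = X mu) (P Q : MvPolynomial (Fin 4) K) :
    coeff (Finsupp.single u 1) (aeval θ₂ P) * coeff (Finsupp.single f 1) (aeval θ₂ Q) -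
        coeff (Finsupp.single f 1) (aeval θ₂ P) * coeff (Finsupp.single u 1) (aeval θ₂ Q) =
      (coeff (Finsupp.single u 1) P * coeff (Finsupp.single f 1) Q -
          coeff (Finsupp.single f 1) P * coeff (Finsupp.single u 1) Q) *
        (coeff (Finsupp.single u 1) (θ₂ u) * coeff (Finsupp.single f 1) (θ₂ f) -
          coeff (Finsupp.single f 1) (θ₂ u) * coeff (Finsupp.single u 1) (θ₂ f)) := by
  classical
  have hvan : ∀ k, k = u ∨ k = f → ∀ i, i ≠ u ∧ i ≠ f → coeff (Finsupp.single k 1) (θ₂ i) = 0 := by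
    rintro k hk i ⟨hiu, hif⟩
    have hi : i = la ∨ i = mu := by
      rcases hex i with h | h | h | h
      · exact Or.inl h
      · exact Or.inr h
      · exact absurd h hiu
      · exact absurd h hif
    have hki : k ≠ i := by
      rintro rfl
      rcases hi with rfl | rfl
      · rcases hk with h | h
        · exact hlu h
        · exact hlf h
      · rcases hk with h | h
        · exact hmu h
        · exact hmf h
    rcases hi with rfl | rfl
    · rw [hla, coeff_X, if_neg]
      exact fun h => hki (Finsupp.single_left_injective one_ne_zero h).symm
    · rw [hmu', coeff_X, if_neg]
      exact fun h => hki (Finsupp.single_left_injective one_ne_zero h).symm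
  have htwo : ∀ k, k = u ∨ k = f → ∀ R : MvPolynomial (Fin 4) K, coeff (Finsupp.single k 1) (aeval θ₂ R) =
      coeff (Finsupp.single u 1) R * coeff (Finsupp.single k 1) (θ₂ u) +
        coeff (Finsupp.single f 1) R * coeff (Finsupp.single k 1) (θ₂ f) := by
    intro k hk R
    rw [coeff_single_aeval_of_origin hθ₂ R k]
    exact Fintype.sum_eq_add u f huf fun i hi => by rw [hvan k hk i hi, mul_zero]
  rw [htwo u (Or.inl rfl) P, htwo f (Or.inr rfl) P, htwo u (Or.inl rfl) Q, htwo f (Or.inr rfl) Q]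
  ring

section Rotation

variable [CharP K 5] [DecidableEq K]

/-- **THE C∞ VIRTUAL ENTRY AT A ROTATION STEP** (statement and route in the module docstring). [OURS]
[cite: CossartJannsenSaito2020, Thm. 3.14, Lemma 13.2] [cite: Hauser2010, §§F–G] -/
theorem exists_cInf_virtual_entry_of_rotation {la mu u f : Fin 4} (hlm : la ≠ mu) (hlu : la ≠ u) (hlf : la ≠ f)
    (hmu : mu ≠ u) (hmf : mu ≠ f) (huf : u ≠ f) {κ κ' : Fin 4} (hκ : (κ = la ∧ κ' = mu) ∨ (κ = mu ∧ κ' = la))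
    {g gt : Fin 4} (hg : (g = u ∧ gt = f) ∨ (g = f ∧ gt = u)) {A' A : State K} {b : Fin 4 → K} (hbg : b g = 0)
    (hbκ : b κ ≠ 0) (hbκ' : b κ' = 0) (hA : A = CentreBlowup.step 5 Finset.univ g b A')
    (hrA' : A'.r = Finsupp.single la 1 + Finsupp.single mu 1) (hdivA' : ∀ e ∈ A'.F.support, A'.r ≤ e)
    (hoA' : ordZero A'.F = (6 : ℕ)) (hcleanA' : deletePthPowers 5 A'.F = A'.F) (hisoA : IsIsolated 5 A.F) {Nc : ℕ}
    (hcert : originIdeal K ^ Nc ≤ singLocusIdeal 5 A.F ⊔ originIdeal K ^ (Nc + 1)) (hoA : ordZero A.F = (6 : ℕ))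
    (he3A : Module.finrank K (resVertex A) = 3) (hrA : A.r = Finsupp.single g 1 + Finsupp.single κ' 1)
    (hdivA : ∀ e ∈ A.F.support, A.r ≤ e) {ℓ : Fin 4 → K} {a0 : K}
    (hform' : resForm A' = C a0 * (∑ i, C (ℓ i) * X i) ^ 4) (hℓf : ℓ f ≠ 0) {U S T : MvPolynomial (Fin 4) K}
    (hU : MvPolynomial.eval (0 : Fin 4 → K) U ≠ 0)
    (hledger : U * (A'.F.divMonomial A'.r) = S * (X la * X mu) + T * (∑ i, C (ℓ i) * X i) ^ 4) (M N : ℕ) :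
    ∃ B₀ : State K,
      (∃ (θ e : Fin 4 → MvPolynomial (Fin 4) K) (U E : MvPolynomial (Fin 4) K),
        θ (Equiv.swap κ g la) = X la * e la ∧ θ (Equiv.swap κ g mu) = X mu * e mu ∧
        constantCoeff (e la) ≠ 0 ∧ constantCoeff (e mu) ≠ 0 ∧
        constantCoeff (θ (Equiv.swap κ g u)) = 0 ∧ constantCoeff (θ (Equiv.swap κ g f)) = 0 ∧
        coeff (Finsupp.single u 1) (θ (Equiv.swap κ g u)) * coeff (Finsupp.single f 1) (θ (Equiv.swap κ g f)) -
          coeff (Finsupp.single f 1) (θ (Equiv.swap κ g u)) * coeff (Finsupp.single u 1) (θ (Equiv.swap κ g f)) ≠ 0 ∧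
        constantCoeff U ≠ 0 ∧ E ∈ originIdeal K ^ M ∧ B₀.F = deletePthPowers 5 (U ^ 5 * aeval θ A.F) + E) ∧
      ordZero B₀.F = 6 ∧ B₀.r = Finsupp.single la 1 + Finsupp.single mu 1 ∧ (∀ d ∈ B₀.F.support, B₀.r ≤ d) ∧
      (∃ a : K, a ≠ 0 ∧ resForm B₀ = C a * X f ^ 4) ∧
      (∀ e ∈ B₀.F.support, e f ≤ 3 → 2 ≤ e la ∧ 2 ≤ e mu) ∧
      (∀ d ∈ B₀.F.support, d.degree < N → ¬ (d u = 2 ∧ d f = 0)) ∧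
      coeff (B₀.r + (Finsupp.single la 1 + Finsupp.single mu 1 + Finsupp.single u 3)) B₀.F ≠ 0 ∧
      IsIsolated 5 B₀.F ∧ Module.finrank K (resVertex B₀) = 3 := by
  haveI : Fact (Nat.Prime 5) := ⟨by norm_num⟩
  -- (0) letters
  have hex : ∀ i : Fin 4, i = la ∨ i = mu ∨ i = u ∨ i = f := letters_exhaust hlm hlu hlf hmu hmf huf
  obtain ⟨hκκ', hκu, hκf, hκ'u, hκ'f⟩ : κ ≠ κ' ∧ κ ≠ u ∧ κ ≠ f ∧ κ' ≠ u ∧ κ' ≠ f := by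
    rcases hκ with ⟨rfl, rfl⟩ | ⟨rfl, rfl⟩
    · exact ⟨hlm, hlu, hlf, hmu, hmf⟩
    · exact ⟨hlm.symm, hmu, hmf, hlu, hlf⟩
  obtain ⟨hκg, hκgt, hκ'g, hκ'gt, hggt⟩ : κ ≠ g ∧ κ ≠ gt ∧ κ' ≠ g ∧ κ' ≠ gt ∧ g ≠ gt := by
    rcases hg with ⟨rfl, rfl⟩ | ⟨rfl, rfl⟩
    · exact ⟨hκu, hκf, hκ'u, hκ'f, huf⟩
    · exact ⟨hκf, hκu, hκ'f, hκ'u, huf.symm⟩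
  have hκlm : κ = la ∨ κ = mu := by
    rcases hκ with ⟨h, -⟩ | ⟨h, -⟩
    · exact Or.inl h
    · exact Or.inr h
  have hpair : Finsupp.single κ 1 + Finsupp.single κ' 1 = (Finsupp.single la 1 + Finsupp.single mu 1 : Fin 4 →₀ ℕ) := by
    rcases hκ with ⟨rfl, rfl⟩ | ⟨rfl, rfl⟩
    · rfl
    · rw [add_comm]
  have hoA'6 : ordZero A'.F = 6 := by rw [hoA']; rfl
  have hoA6 : ordZero A.F = 6 := by rw [hoA]; rfl
  have hA5 : ((5 : ℕ) : ℕ∞) ≤ ordAlong Finset.univ A'.F := by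
    rw [ordAlong_univ, hoA']; exact_mod_cast (by norm_num : 5 ≤ 6)
  have hrA'κ : A'.r κ = 1 := by
    rw [hrA', ← hpair, Finsupp.add_apply, Finsupp.single_eq_same, Finsupp.single_eq_of_ne hκκ', add_zero]
  have hrA'κ' : A'.r κ' = 1 := by
    rw [hrA', ← hpair, Finsupp.add_apply, Finsupp.single_eq_of_ne (Ne.symm hκκ'), Finsupp.single_eq_same, zero_add]
  have hrA'g : A'.r g = 0 := by
    rw [hrA', ← hpair, Finsupp.add_apply, Finsupp.single_eq_of_ne hκg.symm, Finsupp.single_eq_of_ne hκ'g.symm, add_zero]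
  have hrA'gt : A'.r gt = 0 := by
    rw [hrA', ← hpair, Finsupp.add_apply, Finsupp.single_eq_of_ne hκgt.symm, Finsupp.single_eq_of_ne hκ'gt.symm, add_zero]
  -- (1) the trivial relation of the parent to itself: `θ = X`, `e = 1`, `U = 1`, `E = 0`, `π = 1`
  have hθa : (X : Fin 4 → MvPolynomial (Fin 4) K) ((1 : Equiv.Perm (Fin 4)) κ) =
      X κ * (fun _ => (1 : MvPolynomial (Fin 4) K)) κ := by rw [Equiv.Perm.one_apply, mul_one]
  have hθa' : (X : Fin 4 → MvPolynomial (Fin 4) K) ((1 : Equiv.Perm (Fin 4)) κ') =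
      X κ' * (fun _ => (1 : MvPolynomial (Fin 4) K)) κ' := by rw [Equiv.Perm.one_apply, mul_one]
  have hea : constantCoeff ((fun _ => (1 : MvPolynomial (Fin 4) K)) κ) ≠ 0 := by
    dsimp only; rw [map_one]; exact one_ne_zero
  have hea' : constantCoeff ((fun _ => (1 : MvPolynomial (Fin 4) K)) κ') ≠ 0 := by
    dsimp only; rw [map_one]; exact one_ne_zero
  have hg0 : constantCoeff ((X : Fin 4 → MvPolynomial (Fin 4) K) ((1 : Equiv.Perm (Fin 4)) g)) = 0 := by
    rw [Equiv.Perm.one_apply]; exact constantCoeff_X (R := K) g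
  have hgt0 : constantCoeff ((X : Fin 4 → MvPolynomial (Fin 4) K) ((1 : Equiv.Perm (Fin 4)) gt)) = 0 := by
    rw [Equiv.Perm.one_apply]; exact constantCoeff_X (R := K) gt
  have hU1 : constantCoeff (1 : MvPolynomial (Fin 4) K) ≠ 0 := by rw [map_one]; exact one_ne_zero
  have hE0 : (0 : MvPolynomial (Fin 4) K) ∈ originIdeal K ^ (M + Nc + 12) := Submodule.zero_mem _
  have hrel0 : A'.F = deletePthPowers 5 ((1 : MvPolynomial (Fin 4) K) ^ 5 *
      aeval (X : Fin 4 → MvPolynomial (Fin 4) K) A'.F) + 0 := by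
    rw [one_pow, one_mul, MvPolynomial.aeval_X_left, AlgHom.id_apply, hcleanA', add_zero]
  have hbg1 : b ((1 : Equiv.Perm (Fin 4)) g) = 0 := by rw [Equiv.Perm.one_apply]; exact hbg
  have hbκ1 : b ((1 : Equiv.Perm (Fin 4)) κ) ≠ 0 := by rw [Equiv.Perm.one_apply]; exact hbκ
  have hbκ'1 : b ((1 : Equiv.Perm (Fin 4)) κ') = 0 := by rw [Equiv.Perm.one_apply]; exact hbκ'
  have hdetg : coeff (Finsupp.single g 1) ((X : Fin 4 → MvPolynomial (Fin 4) K) ((1 : Equiv.Perm (Fin 4)) g)) *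
        coeff (Finsupp.single gt 1) ((X : Fin 4 → MvPolynomial (Fin 4) K) ((1 : Equiv.Perm (Fin 4)) gt)) -
      coeff (Finsupp.single gt 1) ((X : Fin 4 → MvPolynomial (Fin 4) K) ((1 : Equiv.Perm (Fin 4)) g)) *
        coeff (Finsupp.single g 1) ((X : Fin 4 → MvPolynomial (Fin 4) K) ((1 : Equiv.Perm (Fin 4)) gt)) ≠ 0 := by
    have h1 : coeff (Finsupp.single gt 1) (X g : MvPolynomial (Fin 4) K) = 0 := by
      rw [coeff_X, if_neg]; exact fun h => hggt (Finsupp.single_left_injective one_ne_zero h)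
    rw [Equiv.Perm.one_apply, Equiv.Perm.one_apply, coeff_X_same, coeff_X_same, h1, zero_mul, sub_zero, mul_one]
    exact one_ne_zero
  -- (2) Cramer: the virtual translation `b′` (the same point in the chart of the dropped slot `κ`) and the scalar `λ`
  obtain ⟨lam, b', hb'κ, hb'κ', hLa, hLg, hLgt⟩ := SwapTransport.exists_virtual_translation_rotate
    (π := (1 : Equiv.Perm (Fin 4))) (θ := (X : Fin 4 → MvPolynomial (Fin 4) K))
    (e := fun _ => (1 : MvPolynomial (Fin 4) K)) hκg hκgt hκ'g hκ'gt hggt b hbκ1 hdetg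
  have hlam : lam ≠ 0 := by
    intro h; rw [h, zero_mul] at hLa; exact hea hLa.symm
  -- (3) the two children are related along `(κ g)`
  obtain ⟨θ', e', U', E', hθ'g, hθ'κ', he'κ, he'κ', hκ0', hgt0', hU', hE', hrel', -, -, htana, htangt⟩ :=
    SwapTransport.unitFrame_rotate₂ 5 (1 : Equiv.Perm (Fin 4)) hκκ' hκg hκgt hκ'g hκ'gt hggt (M := M + Nc + 12) (by omega)
      (A := A') (B := A') (θ := (X : Fin 4 → MvPolynomial (Fin 4) K)) (e := fun _ => (1 : MvPolynomial (Fin 4) K))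
      (U := 1) (E := 0) hθa hθa' hea hea' hg0 hgt0 hU1 hE0 hrel0 hA5 hA5 (b := b) (b' := b') (lam := lam) hbg1 hbκ'1 hb'κ
      hb'κ' hLa hLg hLgt
  -- (4) the new free block is invertible
  have hD' : coeff (Finsupp.single g 1) (θ' ((1 : Equiv.Perm (Fin 4)) κ)) *
        coeff (Finsupp.single gt 1) (θ' ((1 : Equiv.Perm (Fin 4)) gt)) -
      coeff (Finsupp.single gt 1) (θ' ((1 : Equiv.Perm (Fin 4)) κ)) *
        coeff (Finsupp.single g 1) (θ' ((1 : Equiv.Perm (Fin 4)) gt)) ≠ 0 := by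
    intro h0
    have h := SwapTransport.det_after_rotate (π := (1 : Equiv.Perm (Fin 4))) (a := κ) (g := g) (gt := gt) hκg hκgt
      (θ := (X : Fin 4 → MvPolynomial (Fin 4) K)) (θ' := θ') (lam := lam)
      (ea := constantCoeff ((fun _ => (1 : MvPolynomial (Fin 4) K)) κ)) (σ := b ((1 : Equiv.Perm (Fin 4)) gt)) hlam
      htana htangt
    rw [h0, mul_zero] at h
    exact mul_ne_zero hea hdetg (neg_eq_zero.mp h.symm)
  simp only [Equiv.Perm.coe_one, id_eq] at hθ'g hθ'κ' hκ0' hgt0' hrel' hD'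
  rw [← hA] at hrel'
  -- (5) the bijection `π₀ = (κ g)` and the relation along it
  have hπκ : Equiv.swap κ g κ = g := Equiv.swap_apply_left κ g
  have hπg : Equiv.swap κ g g = κ := Equiv.swap_apply_right κ g
  have hπκ' : Equiv.swap κ g κ' = κ' := Equiv.swap_apply_of_ne_of_ne (Ne.symm hκκ') hκ'g
  have hπgt : Equiv.swap κ g gt = gt := Equiv.swap_apply_of_ne_of_ne hκgt.symm hggt.symm
  have hθn : θ' ((Equiv.swap κ g) κ) = X κ * e' κ := by rw [hπκ]; exact hθ'g
  have hθn' : θ' ((Equiv.swap κ g) κ') = X κ' * e' κ' := by rw [hπκ']; exact hθ'κ'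
  have hg0n : constantCoeff (θ' ((Equiv.swap κ g) g)) = 0 := by rw [hπg]; exact hκ0'
  have hgt0n : constantCoeff (θ' ((Equiv.swap κ g) gt)) = 0 := by rw [hπgt]; exact hgt0'
  have hdetn : coeff (Finsupp.single g 1) (θ' ((Equiv.swap κ g) g)) * coeff (Finsupp.single gt 1) (θ' ((Equiv.swap κ g) gt)) -
      coeff (Finsupp.single gt 1) (θ' ((Equiv.swap κ g) g)) * coeff (Finsupp.single g 1) (θ' ((Equiv.swap κ g) gt)) ≠ 0 := by
    rw [hπg, hπgt]; exact hD'
  -- (6) isolation and order of the virtual slot child `A₁`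
  obtain ⟨A₁, hA₁⟩ : ∃ A₁ : State K, A₁ = CentreBlowup.step 5 Finset.univ κ b' A' := ⟨_, rfl⟩
  rw [← hA₁] at hrel'
  obtain ⟨hisoA₁, hoA₁⟩ := SwapTransport.read_of_rel₂ 5 (π := Equiv.swap κ g) (a := κ) (a' := κ') (u := g) (f := gt)
    hκκ' hκg hκgt hκ'g hκ'gt hggt (M := M + Nc + 12 - 5) (N := Nc) (o := 6) (FA := A.F) (FB := A₁.F) (θ := θ') (e := e')
    (U := U') (E := E') hθn hθn' he'κ he'κ' hg0n hgt0n hdetn hU' hE' hrel' hisoA hcert (by omega) hoA6 (by norm_num)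
    (by omega)
  -- (7) ledger and divisibility of `A₁`, then `e_G` through the relation (res-dim4-p-7 g4)
  have hrA₁ : A₁.r = Finsupp.single la 1 + Finsupp.single mu 1 := by
    rw [← hpair]
    ext i
    rw [hA₁, SwapTransport.step_r_apply_six hoA'6, Finsupp.add_apply]
    rcases SwapTransport.letters4 hκκ' hκg hκgt hκ'g hκ'gt hggt i with rfl | rfl | rfl | rfl
    · rw [if_pos rfl, Finsupp.single_eq_same, Finsupp.single_eq_of_ne hκκ', add_zero]
    · rw [if_neg (Ne.symm hκκ'), if_pos hb'κ', hrA'κ', Finsupp.single_eq_of_ne (Ne.symm hκκ'), Finsupp.single_eq_same,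
        zero_add]
    · rw [if_neg hκg.symm, hrA'g, ite_self, Finsupp.single_eq_of_ne hκg.symm, Finsupp.single_eq_of_ne hκ'g.symm, add_zero]
    · rw [if_neg hκgt.symm, hrA'gt, ite_self, Finsupp.single_eq_of_ne hκgt.symm, Finsupp.single_eq_of_ne hκ'gt.symm,
        add_zero]
  have hrA₁' : A₁.r = Finsupp.single κ 1 + Finsupp.single κ' 1 := by rw [hrA₁, hpair]
  have hdivA₁ : ∀ d ∈ A₁.F.support, A₁.r ≤ d := by
    rw [hA₁]; exact SwapTransport.forall_le_step_six hoA'6 hdivA' κ hb'κ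
  have hrAπ : A.r = Finsupp.single ((Equiv.swap κ g) κ) 1 + Finsupp.single ((Equiv.swap κ g) κ') 1 := by rw [hπκ, hπκ']; exact hrA
  have he3A₁ : Module.finrank K (resVertex A₁) = 3 := by
    rw [SwapNorm.finrank_resVertex_eq_of_slotUnit_rel₂ 5 (π := Equiv.swap κ g) (u := g) (f := gt) (θ := θ') (e := e')
      hκκ' hκg hκgt hκ'g hκ'gt hggt (A := A) (B := A₁) (U := U') (E := E') (M := M + Nc + 12 - 5) (o := 6) hθn hθn' he'κ
      he'κ' hg0n hgt0n
      (SwapTransport.isUnit_det_slotUnitClass₂ (π := Equiv.swap κ g) (a := κ) (a' := κ') (u := g) (f := gt) hκκ' hκg hκgt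
        hκ'g hκ'gt hggt (θ := θ') (e := e') hθn hθn' he'κ he'κ' hdetn)
      hU' hE' hrel' hrAπ hrA₁' hdivA hoA6 (by norm_num) (by omega)]
    exact he3A
  -- (8) THE ENTRY at the virtual slot step `A₁ = step 5 univ κ b′ A′`
  have hb'la : b' la = 0 := by
    rcases hκ with ⟨rfl, rfl⟩ | ⟨rfl, rfl⟩
    · exact hb'κ
    · exact hb'κ'
  have hb'mu : b' mu = 0 := by
    rcases hκ with ⟨rfl, rfl⟩ | ⟨rfl, rfl⟩
    · exact hb'κ'
    · exact hb'κ
  obtain ⟨B, θ₂, h1, h2, h3, h4, h5, h6, h7, h8, h9, h10, h11, h12, h13, h14, h15⟩ :=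
    exists_cInf_virtual_entry hlm hlu hlf hmu hmf huf hκlm (A' := A') (A := A₁) (β := b') hb'κ hb'la hb'mu hA₁ hrA' hrA₁
      hdivA' hdivA₁ hoA' (by rw [hoA₁]) hcleanA' hisoA₁ he3A₁ hform' hℓf hU hledger N
  -- (9) composition of the two relations
  have hθ₂0 : ∀ i, constantCoeff (θ₂ i) = 0 := fun i => by
    rcases hex i with rfl | rfl | rfl | rfl
    · rw [h1]; exact constantCoeff_X (R := K) _
    · rw [h2]; exact constantCoeff_X (R := K) _
    · exact h3
    · exact h4
  have hθ₂κ : θ₂ κ = X κ := by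
    rcases hκlm with rfl | rfl
    · exact h1
    · exact h2
  have hθ₂κ' : θ₂ κ' = X κ' := by
    rcases hκ with ⟨rfl, rfl⟩ | ⟨rfl, rfl⟩
    · exact h2
    · exact h1
  have hrelB : B.F = deletePthPowers 5 ((aeval θ₂ U') ^ 5 * aeval (fun i => aeval θ₂ (θ' i)) A.F) +
      deletePthPowers 5 (aeval θ₂ E') := by
    rw [h6, hrel', map_add, deletePthPowers_add, SwapTransport.deletePthPowers_aeval_deletePthPowers 5, map_mul,
      map_pow, ApproxCoordChange.aeval_aeval]
  -- the slot relations, units, origin and free block of the composite frame along `π₀ = (κ g)`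
  have hsκ : aeval θ₂ (θ' ((Equiv.swap κ g) κ)) = X κ * aeval θ₂ (e' κ) := by rw [hθn, map_mul, aeval_X, hθ₂κ]
  have hsκ' : aeval θ₂ (θ' ((Equiv.swap κ g) κ')) = X κ' * aeval θ₂ (e' κ') := by rw [hθn', map_mul, aeval_X, hθ₂κ']
  have heκ : constantCoeff (aeval θ₂ (e' κ)) ≠ 0 := by
    rw [CoordChange.constantCoeff_aeval_of_origin _ hθ₂0]; exact he'κ
  have heκ' : constantCoeff (aeval θ₂ (e' κ')) ≠ 0 := by
    rw [CoordChange.constantCoeff_aeval_of_origin _ hθ₂0]; exact he'κ'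
  have hg0c : constantCoeff (aeval θ₂ (θ' ((Equiv.swap κ g) g))) = 0 := by
    rw [CoordChange.constantCoeff_aeval_of_origin _ hθ₂0]; exact hg0n
  have hgt0c : constantCoeff (aeval θ₂ (θ' ((Equiv.swap κ g) gt))) = 0 := by
    rw [CoordChange.constantCoeff_aeval_of_origin _ hθ₂0]; exact hgt0n
  -- in the letters `λ μ u f`
  have hsla : aeval θ₂ (θ' ((Equiv.swap κ g) la)) = X la * aeval θ₂ (e' la) := by
    rcases hκ with ⟨rfl, rfl⟩ | ⟨rfl, rfl⟩
    · exact hsκ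
    · exact hsκ'
  have hsmu : aeval θ₂ (θ' ((Equiv.swap κ g) mu)) = X mu * aeval θ₂ (e' mu) := by
    rcases hκ with ⟨rfl, rfl⟩ | ⟨rfl, rfl⟩
    · exact hsκ'
    · exact hsκ
  have hela : constantCoeff (aeval θ₂ (e' la)) ≠ 0 := by
    rcases hκ with ⟨rfl, rfl⟩ | ⟨rfl, rfl⟩
    · exact heκ
    · exact heκ'
  have hemu : constantCoeff (aeval θ₂ (e' mu)) ≠ 0 := by
    rcases hκ with ⟨rfl, rfl⟩ | ⟨rfl, rfl⟩
    · exact heκ'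
    · exact heκ
  have hu0c : constantCoeff (aeval θ₂ (θ' ((Equiv.swap κ g) u))) = 0 := by
    rcases hg with ⟨rfl, rfl⟩ | ⟨rfl, rfl⟩
    · exact hg0c
    · exact hgt0c
  have hf0c : constantCoeff (aeval θ₂ (θ' ((Equiv.swap κ g) f))) = 0 := by
    rcases hg with ⟨rfl, rfl⟩ | ⟨rfl, rfl⟩
    · exact hgt0c
    · exact hg0c
  have hdetuf : coeff (Finsupp.single u 1) (θ' ((Equiv.swap κ g) u)) * coeff (Finsupp.single f 1) (θ' ((Equiv.swap κ g) f)) -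
      coeff (Finsupp.single f 1) (θ' ((Equiv.swap κ g) u)) * coeff (Finsupp.single u 1) (θ' ((Equiv.swap κ g) f)) ≠ 0 := by
    rcases hg with ⟨rfl, rfl⟩ | ⟨rfl, rfl⟩
    · exact hdetn
    · exact fun h => hdetn (by linear_combination h)
  have hdetc : coeff (Finsupp.single u 1) (aeval θ₂ (θ' ((Equiv.swap κ g) u))) * coeff (Finsupp.single f 1) (aeval θ₂ (θ' ((Equiv.swap κ g) f))) -
      coeff (Finsupp.single f 1) (aeval θ₂ (θ' ((Equiv.swap κ g) u))) * coeff (Finsupp.single u 1) (aeval θ₂ (θ' ((Equiv.swap κ g) f))) ≠ 0 := by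
    rw [det_free_block_comp hlu hlf hmu hmf huf hex hθ₂0 h1 h2]
    exact mul_ne_zero hdetuf h5
  have hUc : constantCoeff (aeval θ₂ U') ≠ 0 := by
    rw [CoordChange.constantCoeff_aeval_of_origin _ hθ₂0]; exact hU'
  have hEc : deletePthPowers 5 (aeval θ₂ E') ∈ originIdeal K ^ M :=
    Ideal.pow_le_pow_right (by omega) (SwapNorm.deletePthPowers_mem_pow 5 (SwapNorm.aeval_mem_pow hθ₂0 hE'))
  exact ⟨B, ⟨fun i => aeval θ₂ (θ' i), fun i => aeval θ₂ (e' i), aeval θ₂ U', deletePthPowers 5 (aeval θ₂ E'),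
    hsla, hsmu, hela, hemu, hu0c, hf0c, hdetc, hUc, hEc, hrelB⟩, by rw [h7]; rfl, h8, h9, h10, h11, h12, h13, h14, h15⟩

end Rotation

end ResCone

end Summit.ResolutionOfSingularities.ResolutionOfSingularities.Theorems.PIDim4

end
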